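import Summits.BirchSwinnertonDyer.BirchSwinnertonDyer.Theorems.ByReductionTypeAtTwoTowerLayerSharp
import Literature.NumberTheory.EllipticCurves.Greenberg1999.ControlLocalKernelAtPStructure
import HarnessLib

/-!
# The TOWER gap certificate with NUMERIC local constants: every odd-bad-prime factor read from PRINT
# (Greenberg LNM 1716 p. 88: multiplicative ⇒ `C_v ∈ {1, 2}`, additive ⇒ `C_v = 4`; p. 89: `C_2 = 4`)
# — no `B_v`-object, no `β`, no per-prime proof obligation beyond arithmetic (route ByReductionTypeAtTwo,
# crux `OrdKatoHalfAtTwo`, item stmt-BirchSwinnertonDyer-19271; seat bsd-2adic-tower-1 GEN 2, part 7)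

HONEST FRAMING (cell `bsd-2adic`, run/shared/lean/pub/bsd-2adic/, HUMAN RULINGS D-0036/D-0074): THEOREMS
ONLY; nothing asserted; no definition; no new named fact; closes nothing by itself. BSD is NOT proved by
any of this: a discharge closes a rung leaf of the `2`-adic class list, modulo the PUBLISHED inputs named
below (hypotheses BY NAME) and per-curve CERTIFICATES (computations, evidence-carried).

GEN 0's doors (parts 3b/4) and part 6 carry, at each odd `v ∈ S`, the binder
`hβ : #B_v/(B_v)_div ≤ β_v` — a statement about a Galois-theoretic object that no per-curve computation
in the tree can discharge. Here it is REPLACED by the printed evaluation (Literature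
`Greenberg1999/ControlLocalKernelsLayer.lean`, addendum p433351; `…/ControlLocalKernelAtPStructure.lean`,
p433907):
* `hM` = `lemma33_localTowerKerPrimary_cyclic_of_multiplicative` (p. 88): multiplicative `v ∤ 2` ⇒
  `𝒦_{v,n}[2^∞]` cyclic of order `∣ 2^{v₂(ord_v Δ_min)}` ⇒ `#𝒦_{v,n}[2] ≤ 2`, and `= 1` if `2 ∤ ord_v(Δ)`;
* `hA` = `lemma33_natCard_localTowerKerPrimary_le_four_of_additive` (p. 88): additive `v ∤ 2` ⇒ `≤ 4`;
* `h33g` (p. 86): good `v ∤ 2` ⇒ `0`;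
* `hS34` = `lemma34_localTowerKerPrimary_cyclicExtension_rat` (p. 89 + Prop. 2.5): at `v = (2)`, good
  ordinary, `#𝒦_{2,n}[2] ≤ 4` for BOTH `a₂ = ±1` (GEN 0 used `|Ẽ(𝔽₂)_2|² ∈ {4, 16}`).
Since every place is good, multiplicative or additive (tree trichotomy
`hasGoodReductionAt_or_hasMultiplicativeReductionAt_or_hasAdditiveReductionAt`), the local constant
`C_v = 4` needs NO per-prime proof at all; sharper constants are unlocked by proving the reduction type
(`2`: multiplicative; `1`: multiplicative with `2 ∤ ord_v(Δ_min)`, or good) — the disjunctive certificate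
`hC` below. Doors: `towerGapAtTwo_of_layerSelmer_numeric`; `Ш`-currency
`bsdp_two_/mazurMainConjecture_two_of_layerSelmer_numeric_of_missingLowerBoundAt` (rank `0`; PRINT
{modularity, GZK, Kato 17.4 (1)(2)@2, Greenberg Thm. 4.1@2, L.3.3@2 ×3 readings, L.3.4@2 structure} +
CERTIFICATES {`hper₀`, odd torsion, `S`, `hlow`, `hup`, `hC`, arithmetic, `MissingLowerBoundAt W 2`});
`λ`-road `katoHalfAt_two_of_layerSelmer_numeric` (the item AT `W`; + Prop. 4.14, `hrank`, `λ_an`, `μ_an`).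

The arithmetic to certify (all numbers per curve; `ℓ_v = natGenerator v`):
`2^d · 4 · ∏_{v ∈ S odd} C_v^{2^{min(j', v₂(ℓ_v² − 1) − 3)}} < 2^{2^{j'} − 2^j + a}`.

References: R. Greenberg, LNM 1716 (1999), §3 pp. 86–89, Prop. 2.5, Thm. 4.1, Prop. 4.14; K. Kato,
Astérisque 295 (2004), Thm. 17.4; L. Washington, *Introduction to Cyclotomic Fields*, §13.
-/

set_option autoImplicit false

noncomputable section

open scoped Classical MatrixGroups ModularForm

open NumberField IsDedekindDomain CongruenceSubgroup WeierstrassCurve Literature.NumberTheory.EllipticCurves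
  Literature.NumberTheory.EllipticCurves.ModularForms Literature.NumberTheory.EllipticCurves.Rank1Residual
  Literature.NumberTheory.EllipticCurves.Rank1Residual.Typed
  Literature.NumberTheory.EllipticCurves.Greenberg1999
  Summit.BirchSwinnertonDyer.Rank1Residual.X1.MuLambda
  Summit.BirchSwinnertonDyer.Rank1Residual.X1.MuPart
  Summit.BirchSwinnertonDyer.Rank1Residual.X1.ParitySqueeze
  Summit.BirchSwinnertonDyer.BirchSwinnertonDyer.Theorems.Rank1ResidualX1Defs
  Summit.BirchSwinnertonDyer.Rank1Residual.X5 Summit.BirchSwinnertonDyer.Rank1Residual.X5.O1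
  Summit.BirchSwinnertonDyer.Rank1Residual.X5.TowerGap
  Summit.BirchSwinnertonDyer.Rank1Residual

namespace Summit.BirchSwinnertonDyer.BirchSwinnertonDyer.Theorems.KatoHalfPinch

section Curve

variable (W : WeierstrassCurve ℚ) [W.IsElliptic] [W.IsGloballyMinimal]

omit [W.IsGloballyMinimal] in
/-- Bookkeeping: a trivial subgroup has exactly one `p`-torsion class. [folklore] -/
theorem finite_and_natCard_pTorsion_le_one_of_eq_bot {G : Type} [AddCommGroup G]
    {H : AddSubgroup G} (h : H = ⊥) (p : ℕ) :
    Finite {x : H // p • x = 0} ∧ Nat.card {x : H // p • x = 0} ≤ 1 := by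
  subst h
  haveI : Subsingleton {x : (⊥ : AddSubgroup G) // p • x = 0} :=
    ⟨fun x y ↦ Subtype.ext (Subsingleton.elim _ _)⟩
  exact ⟨Finite.of_subsingleton, Finite.card_le_one_iff_subsingleton.mpr inferInstance⟩

omit [W.IsGloballyMinimal] in
/-- **The local constant at an odd place, from PRINT.** For `W/ℚ` elliptic, `κ` cyclotomic at `2`,
an odd place `v` and a layer `n`: `#𝒦_{v,n}[2] ≤ C` as soon as ONE of: `4 ≤ C` (any reduction type:
trichotomy + p. 86/88 readings), or `v` multiplicative and `2 ≤ C`, or `v` multiplicative with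
`2 ∤ ord_v(Δ_min)` and `1 ≤ C`, or `v` good and `1 ≤ C`.
[cite: GreenbergLNM1716, §3 Lemma 3.3 (PDF pp. 86–88)] -/
theorem pTorsion_localTowerKer_le_of_numeric
    (h33g : lemma33_localTowerKerPrimary_eq_bot_of_good.{0})
    (hM : lemma33_localTowerKerPrimary_cyclic_of_multiplicative.{0})
    (hA : lemma33_natCard_localTowerKerPrimary_le_four_of_additive.{0})
    (κ : ZpExtension ℚ 2) (hκ : κ.IsCyclotomic) (v : HeightOneSpectrum (𝓞 ℚ))
    (h2v : ((2 : ℕ) : 𝓞 ℚ) ∉ v.asIdeal) (n C : ℕ)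
    (hC : 4 ≤ C ∨ (W.HasMultiplicativeReductionAt v ∧ 2 ≤ C) ∨
      (W.HasMultiplicativeReductionAt v ∧ ¬ 2 ∣ W.ordMinimalDiscriminant v ∧ 1 ≤ C) ∨
      (W.HasGoodReductionAt v ∧ 1 ≤ C)) :
    Finite {x : W.localTowerKerPrimary κ (v.adicCompletion ℚ) n // 2 • x = 0} ∧
      Nat.card {x : W.localTowerKerPrimary κ (v.adicCompletion ℚ) n // 2 • x = 0} ≤ C := by
  haveI : Fact (Nat.Prime 2) := ⟨Nat.prime_two⟩
  -- the three printed evaluations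
  have hgood : W.HasGoodReductionAt v →
      Finite {x : W.localTowerKerPrimary κ (v.adicCompletion ℚ) n // 2 • x = 0} ∧
        Nat.card {x : W.localTowerKerPrimary κ (v.adicCompletion ℚ) n // 2 • x = 0} ≤ 1 :=
    fun hg ↦ finite_and_natCard_pTorsion_le_one_of_eq_bot (h33g ℚ W 2 κ hκ v h2v hg n) 2
  have hmult : W.HasMultiplicativeReductionAt v →
      Finite {x : W.localTowerKerPrimary κ (v.adicCompletion ℚ) n // 2 • x = 0} ∧
        Nat.card {x : W.localTowerKerPrimary κ (v.adicCompletion ℚ) n // 2 • x = 0} ≤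
          (if 2 ∣ W.ordMinimalDiscriminant v then 2 else 1) :=
    fun hm ↦ pTorsion_le_of_lemma33_multiplicative hM W 2 κ hκ v h2v hm n
  have hadd : W.HasAdditiveReductionAt v →
      Finite {x : W.localTowerKerPrimary κ (v.adicCompletion ℚ) n // 2 • x = 0} ∧
        Nat.card {x : W.localTowerKerPrimary κ (v.adicCompletion ℚ) n // 2 • x = 0} ≤ 4 :=
    fun ha ↦ pTorsion_le_of_lemma33_additive hA W 2 κ hκ v h2v ha n
  have hmult2 : W.HasMultiplicativeReductionAt v →
      Finite {x : W.localTowerKerPrimary κ (v.adicCompletion ℚ) n // 2 • x = 0} ∧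
        Nat.card {x : W.localTowerKerPrimary κ (v.adicCompletion ℚ) n // 2 • x = 0} ≤ 2 := by
    intro hm
    obtain ⟨hf, hle⟩ := hmult hm
    refine ⟨hf, hle.trans ?_⟩
    split_ifs <;> omega
  rcases hC with h4 | ⟨hm, h2⟩ | ⟨hm, hodd, h1⟩ | ⟨hg, h1⟩
  · -- any type: trichotomy
    rcases hasGoodReductionAt_or_hasMultiplicativeReductionAt_or_hasAdditiveReductionAt v W with
      hg | hm | ha
    · obtain ⟨hf, hle⟩ := hgood hg; exact ⟨hf, by omega⟩
    · obtain ⟨hf, hle⟩ := hmult2 hm; exact ⟨hf, by omega⟩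
    · obtain ⟨hf, hle⟩ := hadd ha; exact ⟨hf, by omega⟩
  · obtain ⟨hf, hle⟩ := hmult2 hm; exact ⟨hf, by omega⟩
  · obtain ⟨hf, hle⟩ := hmult hm
    rw [if_neg hodd] at hle
    exact ⟨hf, by omega⟩
  · obtain ⟨hf, hle⟩ := hgood hg; exact ⟨hf, by omega⟩

/-- Bookkeeping: `4 = 2²`, the structure bound at `v = (2)` in the shape consumed below. [folklore] -/
theorem pTorsion_localTowerKer_at_two_le_four
    (hS34 : lemma34_localTowerKerPrimary_cyclicExtension_rat) (hgo : GoodOrd W 2)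
    (κ : ZpExtension ℚ 2) (hκ : κ.IsCyclotomic) (v : HeightOneSpectrum (𝓞 ℚ))
    (h2v : ((2 : ℕ) : 𝓞 ℚ) ∈ v.asIdeal) (n : ℕ) :
    Finite {x : W.localTowerKerPrimary κ (v.adicCompletion ℚ) n // 2 • x = 0} ∧
      Nat.card {x : W.localTowerKerPrimary κ (v.adicCompletion ℚ) n // 2 • x = 0} ≤ 4 := by
  haveI : Fact (Nat.Prime 2) := ⟨Nat.prime_two⟩
  have hord : IsOrdinaryAt W 2 := hgo
  have h := pTorsion_le_sq_of_lemma34_structure hS34 W 2 hord κ hκ v h2v n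
  exact ⟨h.1, h.2.trans (by norm_num)⟩

/-- **The GAP certificate with NUMERIC local constants.** `W/ℚ` good ordinary at `2` with odd torsion
order; layers `j ≤ j'`; `S` a finite set of finite places off which every place is odd and good (`hS`);
PRINT: `h33g`, `hM`, `hA` (Greenberg L.3.3, p. 86/88, at every layer), `hS34` (L.3.4 structure, p. 89);
CERTIFICATES: `2^a ≤ #Sel_{2^∞}(E/ℚ_j)[2]`, `#Sel_{2^∞}(E/ℚ_{j'})[2] ≤ 2^d`, a numeric `C_v` at each odd
`v ∈ S` justified by ONE disjunct of `hC` (`4 ≤ C_v` needs nothing), and the arithmetic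
`2^d · ∏_{v ∈ S} (2 ∈ v ? 4 : C_v)^{(2 ∈ v ? 1 : 2^{min(j', v₂(ℓ_v² − 1) − 3)})} < 2^{2^{j'} − 2^j + a}`.
Then `O1.TowerGapAtTwo W`. [cite: GreenbergLNM1716, §3 Lemmas 3.3–3.5 (PDF pp. 86–90), Prop. 2.5]
[cite: Washington1997, §13.1] -/
theorem towerGapAtTwo_of_layerSelmer_numeric
    (h33g : lemma33_localTowerKerPrimary_eq_bot_of_good.{0})
    (hM : lemma33_localTowerKerPrimary_cyclic_of_multiplicative.{0})
    (hA : lemma33_natCard_localTowerKerPrimary_le_four_of_additive.{0})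
    (hS34 : lemma34_localTowerKerPrimary_cyclicExtension_rat)
    (hgo : GoodOrd W 2) (htors : ¬ 2 ∣ W.torsionOrder) {j j' a d : ℕ} (hjj' : j ≤ j')
    (S : Finset (HeightOneSpectrum (𝓞 ℚ)))
    (hS : ∀ v ∉ S, ((2 : ℕ) : 𝓞 ℚ) ∉ v.asIdeal ∧ W.HasGoodReductionAt v)
    (C : HeightOneSpectrum (𝓞 ℚ) → ℕ)
    (hC : ∀ v ∈ S, ((2 : ℕ) : 𝓞 ℚ) ∉ v.asIdeal →
      4 ≤ C v ∨ (W.HasMultiplicativeReductionAt v ∧ 2 ≤ C v) ∨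
        (W.HasMultiplicativeReductionAt v ∧ ¬ 2 ∣ W.ordMinimalDiscriminant v ∧ 1 ≤ C v) ∨
        (W.HasGoodReductionAt v ∧ 1 ≤ C v))
    (hlow : ∀ κ : ZpExtension ℚ 2, κ.IsCyclotomic →
      2 ^ a ≤ Nat.card {z : W.selmerLayer κ j // 2 • z = 0})
    (hup : ∀ κ : ZpExtension ℚ 2, κ.IsCyclotomic →
      Nat.card {z : W.selmerLayer κ j' // 2 • z = 0} ≤ 2 ^ d)
    (harith : 2 ^ d * ∏ v ∈ S, (if ((2 : ℕ) : 𝓞 ℚ) ∈ v.asIdeal then 4 else C v) ^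
        (if ((2 : ℕ) : 𝓞 ℚ) ∈ v.asIdeal then 1
          else 2 ^ min j' (padicValNat 2 (Rat.HeightOneSpectrum.natGenerator v ^ 2 - 1) - 3)) <
      2 ^ (2 ^ j' - 2 ^ j + a)) : TowerGapAtTwo W := by
  refine towerGapAtTwo_of_localKernelBounds_sharp W htors hjj' S
    (fun v ↦ if ((2 : ℕ) : 𝓞 ℚ) ∈ v.asIdeal then 4 else C v) hlow hup
    (fun κ hκ v hv ↦ h33g ℚ W 2 κ hκ v (hS v hv).1 (hS v hv).2 j') (fun κ hκ v hv ↦ ?_) harith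
  by_cases h2 : ((2 : ℕ) : 𝓞 ℚ) ∈ v.asIdeal
  · rw [if_pos h2]
    exact pTorsion_localTowerKer_at_two_le_four W hS34 hgo κ hκ v h2 j'
  · rw [if_neg h2]
    exact pTorsion_localTowerKer_le_of_numeric W h33g hM hA κ hκ v h2 j' (C v) (hC v hv h2)

/-! ### Doors in `Ш`-currency with numeric local constants -/

/-- **Door (TOWER gap, numeric local constants ∘ `Ш`-currency) for `BSD(E,2)` at analytic rank `0`**
on a good-ordinary-at-`2` curve with odd torsion order. PRINT (named facts, displayed): modularity
`hmod`, GZK `hGZK`, Kato 17.4 (1)(2)@2 `h17`, Greenberg Thm. 4.1@2 `hEC`, Lemma 3.3@2 readings `h33g`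
(good), `hM` (multiplicative), `hA` (additive), Lemma 3.4@2 structure `hS34`. CERTIFICATES: Néron
integrality `hper₀`, odd torsion, the set `S` (`hS`), layer Selmer counts `hlow`/`hup`, numeric local
constants `hC`, the arithmetic, and the descent inequality `MissingLowerBoundAt W 2`. NO `B_v`, NO `β`,
NO rank / `λ_an` / `μ_an` certificate, NO Prop. 4.14. [cite: GreenbergLNM1716, Thm. 4.1 (p. 102), §3 Lemmas 3.3–3.5, Prop. 2.5]
[cite: Kato2004Asterisque, Thm. 17.4 (1)(2) (p. 273)] [cite: Miller2011LMS, Def. 1.1] -/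
theorem bsdp_two_of_layerSelmer_numeric_of_missingLowerBoundAt
    (hmod : nonempty_modularParametrizationData) (hGZK : rank_eq_analyticRank_of_analyticRank_le_one)
    (h17 : ∀ [NeZero (W.conductorNorm ℤ)] (f : CuspForm (Gamma0 (W.conductorNorm ℤ)) 2),
      kato_divisibility_allPrimes W 2 (f := f))
    (hEC : TwoAdicEulerCharRankZero W 0)
    (h33g : lemma33_localTowerKerPrimary_eq_bot_of_good.{0})
    (hM : lemma33_localTowerKerPrimary_cyclic_of_multiplicative.{0})
    (hA : lemma33_natCard_localTowerKerPrimary_le_four_of_additive.{0})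
    (hS34 : lemma34_localTowerKerPrimary_cyclicExtension_rat)
    (hper₀ : ∀ [NeZero (W.conductorNorm ℤ)] (f : CuspForm (Gamma0 (W.conductorNorm ℤ)) 2),
      IsNewformOf W f → ∀ ϖ : ℚ, (ϖ : ℝ) * W.realPeriodRat = plusPeriod f → 0 ≤ padicValRat 2 ϖ)
    (hgo : GoodOrd W 2) (hr : W.analyticRank = 0) (htors : ¬ 2 ∣ W.torsionOrder) {j j' a d : ℕ}
    (hjj' : j ≤ j') (S : Finset (HeightOneSpectrum (𝓞 ℚ)))
    (hS : ∀ v ∉ S, ((2 : ℕ) : 𝓞 ℚ) ∉ v.asIdeal ∧ W.HasGoodReductionAt v)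
    (C : HeightOneSpectrum (𝓞 ℚ) → ℕ)
    (hC : ∀ v ∈ S, ((2 : ℕ) : 𝓞 ℚ) ∉ v.asIdeal →
      4 ≤ C v ∨ (W.HasMultiplicativeReductionAt v ∧ 2 ≤ C v) ∨
        (W.HasMultiplicativeReductionAt v ∧ ¬ 2 ∣ W.ordMinimalDiscriminant v ∧ 1 ≤ C v) ∨
        (W.HasGoodReductionAt v ∧ 1 ≤ C v))
    (hlow : ∀ κ : ZpExtension ℚ 2, κ.IsCyclotomic →
      2 ^ a ≤ Nat.card {z : W.selmerLayer κ j // 2 • z = 0})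
    (hup : ∀ κ : ZpExtension ℚ 2, κ.IsCyclotomic →
      Nat.card {z : W.selmerLayer κ j' // 2 • z = 0} ≤ 2 ^ d)
    (harith : 2 ^ d * ∏ v ∈ S, (if ((2 : ℕ) : 𝓞 ℚ) ∈ v.asIdeal then 4 else C v) ^
        (if ((2 : ℕ) : 𝓞 ℚ) ∈ v.asIdeal then 1
          else 2 ^ min j' (padicValNat 2 (Rat.HeightOneSpectrum.natGenerator v ^ 2 - 1) - 3)) <
      2 ^ (2 ^ j' - 2 ^ j + a))
    (hsha : MissingLowerBoundAt W 2) : BSDp W 2 :=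
  EisensteinShaCurrency.bsdp_two_of_towerGap_of_missingLowerBoundAt W h17 hper₀ hEC hGZK hmod hgo hr
    (towerGapAtTwo_of_layerSelmer_numeric W h33g hM hA hS34 hgo htors hjj' S hS C hC hlow hup harith)
    hsha

/-- **Door (TOWER gap, numeric local constants ∘ `Ш`-currency): `MazurMainConjecture W 2`** at a
rank-`0` good-ordinary `W` with odd torsion order (so in particular the item `OrdKatoHalfAtTwo` AT `W`),
from the same PRINT + CERTIFICATES as `bsdp_two_of_layerSelmer_numeric_of_missingLowerBoundAt`.
[cite: Kato2004Asterisque, Thm. 17.4 (1)(2) (p. 273)] [cite: GreenbergLNM1716, Thm. 4.1 (p. 102), §3 Lemmas 3.3–3.5, Prop. 2.5] -/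
theorem mazurMainConjecture_two_of_layerSelmer_numeric_of_missingLowerBoundAt
    (hmod : nonempty_modularParametrizationData) (hGZK : rank_eq_analyticRank_of_analyticRank_le_one)
    (h17 : ∀ [NeZero (W.conductorNorm ℤ)] (f : CuspForm (Gamma0 (W.conductorNorm ℤ)) 2),
      kato_divisibility_allPrimes W 2 (f := f))
    (hEC : TwoAdicEulerCharRankZero W 0)
    (h33g : lemma33_localTowerKerPrimary_eq_bot_of_good.{0})
    (hM : lemma33_localTowerKerPrimary_cyclic_of_multiplicative.{0})
    (hA : lemma33_natCard_localTowerKerPrimary_le_four_of_additive.{0})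
    (hS34 : lemma34_localTowerKerPrimary_cyclicExtension_rat)
    (hper₀ : ∀ [NeZero (W.conductorNorm ℤ)] (f : CuspForm (Gamma0 (W.conductorNorm ℤ)) 2),
      IsNewformOf W f → ∀ ϖ : ℚ, (ϖ : ℝ) * W.realPeriodRat = plusPeriod f → 0 ≤ padicValRat 2 ϖ)
    (hgo : GoodOrd W 2) (hr : W.analyticRank = 0) (htors : ¬ 2 ∣ W.torsionOrder) {j j' a d : ℕ}
    (hjj' : j ≤ j') (S : Finset (HeightOneSpectrum (𝓞 ℚ)))
    (hS : ∀ v ∉ S, ((2 : ℕ) : 𝓞 ℚ) ∉ v.asIdeal ∧ W.HasGoodReductionAt v)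
    (C : HeightOneSpectrum (𝓞 ℚ) → ℕ)
    (hC : ∀ v ∈ S, ((2 : ℕ) : 𝓞 ℚ) ∉ v.asIdeal →
      4 ≤ C v ∨ (W.HasMultiplicativeReductionAt v ∧ 2 ≤ C v) ∨
        (W.HasMultiplicativeReductionAt v ∧ ¬ 2 ∣ W.ordMinimalDiscriminant v ∧ 1 ≤ C v) ∨
        (W.HasGoodReductionAt v ∧ 1 ≤ C v))
    (hlow : ∀ κ : ZpExtension ℚ 2, κ.IsCyclotomic →
      2 ^ a ≤ Nat.card {z : W.selmerLayer κ j // 2 • z = 0})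
    (hup : ∀ κ : ZpExtension ℚ 2, κ.IsCyclotomic →
      Nat.card {z : W.selmerLayer κ j' // 2 • z = 0} ≤ 2 ^ d)
    (harith : 2 ^ d * ∏ v ∈ S, (if ((2 : ℕ) : 𝓞 ℚ) ∈ v.asIdeal then 4 else C v) ^
        (if ((2 : ℕ) : 𝓞 ℚ) ∈ v.asIdeal then 1
          else 2 ^ min j' (padicValNat 2 (Rat.HeightOneSpectrum.natGenerator v ^ 2 - 1) - 3)) <
      2 ^ (2 ^ j' - 2 ^ j + a))
    (hsha : MissingLowerBoundAt W 2) : MazurMainConjecture W 2 :=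
  EisensteinShaCurrency.mazurMainConjecture_two_of_towerGap_of_missingLowerBoundAt W h17 hper₀ hEC
    hGZK hmod hgo hr
    (towerGapAtTwo_of_layerSelmer_numeric W h33g hM hA hS34 hgo htors hjj' S hS C hC hlow hup harith)
    hsha

/-! ### The `λ`-road with numeric local constants: the item AT `W` (any analytic rank) -/

/-- **The Kato–Néron half (the item `OrdKatoHalfAtTwo` AT `W`), numeric local constants**, any analytic
rank, odd torsion order: PRINT {Kato 17.4 (1)(2)@2 `h17`, Prop. 4.14@2 `h414`, L.3.3@2 readings `h33g`,
`hM`, `hA`, L.3.4@2 structure `hS34`} + CERTIFICATES {`hper₀`, rank `2^n ≤ #Sel_{2^∞}(E/ℚ_{j₀})[2]`,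
`λ_an = n`, `μ_an = 0`, `S`, `hlow`, `hup`, `hC`, arithmetic}.
[cite: Kato2004Asterisque, Thm. 17.4 (1)(2) (p. 273)] [cite: GreenbergLNM1716, Prop. 4.14, §3 Lemmas 3.3–3.5, Prop. 2.5] -/
theorem katoHalfAt_two_of_layerSelmer_numeric
    (h17 : ∀ [NeZero (W.conductorNorm ℤ)] (f : CuspForm (Gamma0 (W.conductorNorm ℤ)) 2),
      kato_divisibility_allPrimes W 2 (f := f))
    (h414 : prop414_noFiniteSubmodule_of_not_dvd_torsionOrder)
    (h33g : lemma33_localTowerKerPrimary_eq_bot_of_good.{0})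
    (hM : lemma33_localTowerKerPrimary_cyclic_of_multiplicative.{0})
    (hA : lemma33_natCard_localTowerKerPrimary_le_four_of_additive.{0})
    (hS34 : lemma34_localTowerKerPrimary_cyclicExtension_rat)
    (hper₀ : ∀ [NeZero (W.conductorNorm ℤ)] (f : CuspForm (Gamma0 (W.conductorNorm ℤ)) 2),
      IsNewformOf W f → ∀ ϖ : ℚ, (ϖ : ℝ) * W.realPeriodRat = plusPeriod f → 0 ≤ padicValRat 2 ϖ)
    (hgo : GoodOrd W 2) (htors : ¬ 2 ∣ W.torsionOrder) {n j₀ j j' a d : ℕ}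
    (hrank : ∀ κ : ZpExtension ℚ 2, κ.IsCyclotomic →
      2 ^ n ≤ Nat.card {z : W.selmerLayer κ j₀ // 2 • z = 0})
    (hjj' : j ≤ j') (S : Finset (HeightOneSpectrum (𝓞 ℚ)))
    (hS : ∀ v ∉ S, ((2 : ℕ) : 𝓞 ℚ) ∉ v.asIdeal ∧ W.HasGoodReductionAt v)
    (C : HeightOneSpectrum (𝓞 ℚ) → ℕ)
    (hC : ∀ v ∈ S, ((2 : ℕ) : 𝓞 ℚ) ∉ v.asIdeal →
      4 ≤ C v ∨ (W.HasMultiplicativeReductionAt v ∧ 2 ≤ C v) ∨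
        (W.HasMultiplicativeReductionAt v ∧ ¬ 2 ∣ W.ordMinimalDiscriminant v ∧ 1 ≤ C v) ∨
        (W.HasGoodReductionAt v ∧ 1 ≤ C v))
    (hlow : ∀ κ : ZpExtension ℚ 2, κ.IsCyclotomic →
      2 ^ a ≤ Nat.card {z : W.selmerLayer κ j // 2 • z = 0})
    (hup : ∀ κ : ZpExtension ℚ 2, κ.IsCyclotomic →
      Nat.card {z : W.selmerLayer κ j' // 2 • z = 0} ≤ 2 ^ d)
    (harith : 2 ^ d * ∏ v ∈ S, (if ((2 : ℕ) : 𝓞 ℚ) ∈ v.asIdeal then 4 else C v) ^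
        (if ((2 : ℕ) : 𝓞 ℚ) ∈ v.asIdeal then 1
          else 2 ^ min j' (padicValNat 2 (Rat.HeightOneSpectrum.natGenerator v ^ 2 - 1) - 3)) <
      2 ^ (2 ^ j' - 2 ^ j + a))
    (hlan : AnalyticLambdaEq W 2 n) (hμan : AnalyticMuLE W 2 0) :
    MainConjectureLowerDivisibilityAtTwoOrd W :=
  katoHalfAt_two_of_towerGap_of_layerSelmer W h17 h414 hper₀ hgo htors
    (towerGapAtTwo_of_layerSelmer_numeric W h33g hM hA hS34 hgo htors hjj' S hS C hC hlow hup harith)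
    hrank hlan hμan

/-- **`MazurMainConjecture W 2` on the `λ`-road, numeric local constants** — any analytic rank, odd
torsion order. [cite: Kato2004Asterisque, Thm. 17.4 (1)(2) (p. 273)] [cite: GreenbergLNM1716, Prop. 4.14, §3 Lemmas 3.3–3.5, Prop. 2.5] -/
theorem mazurMainConjecture_two_of_layerSelmer_numeric
    (h17 : ∀ [NeZero (W.conductorNorm ℤ)] (f : CuspForm (Gamma0 (W.conductorNorm ℤ)) 2),
      kato_divisibility_allPrimes W 2 (f := f))
    (h414 : prop414_noFiniteSubmodule_of_not_dvd_torsionOrder)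
    (h33g : lemma33_localTowerKerPrimary_eq_bot_of_good.{0})
    (hM : lemma33_localTowerKerPrimary_cyclic_of_multiplicative.{0})
    (hA : lemma33_natCard_localTowerKerPrimary_le_four_of_additive.{0})
    (hS34 : lemma34_localTowerKerPrimary_cyclicExtension_rat)
    (hper₀ : ∀ [NeZero (W.conductorNorm ℤ)] (f : CuspForm (Gamma0 (W.conductorNorm ℤ)) 2),
      IsNewformOf W f → ∀ ϖ : ℚ, (ϖ : ℝ) * W.realPeriodRat = plusPeriod f → 0 ≤ padicValRat 2 ϖ)
    (hgo : GoodOrd W 2) (htors : ¬ 2 ∣ W.torsionOrder) {n j₀ j j' a d : ℕ}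
    (hrank : ∀ κ : ZpExtension ℚ 2, κ.IsCyclotomic →
      2 ^ n ≤ Nat.card {z : W.selmerLayer κ j₀ // 2 • z = 0})
    (hjj' : j ≤ j') (S : Finset (HeightOneSpectrum (𝓞 ℚ)))
    (hS : ∀ v ∉ S, ((2 : ℕ) : 𝓞 ℚ) ∉ v.asIdeal ∧ W.HasGoodReductionAt v)
    (C : HeightOneSpectrum (𝓞 ℚ) → ℕ)
    (hC : ∀ v ∈ S, ((2 : ℕ) : 𝓞 ℚ) ∉ v.asIdeal →
      4 ≤ C v ∨ (W.HasMultiplicativeReductionAt v ∧ 2 ≤ C v) ∨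
        (W.HasMultiplicativeReductionAt v ∧ ¬ 2 ∣ W.ordMinimalDiscriminant v ∧ 1 ≤ C v) ∨
        (W.HasGoodReductionAt v ∧ 1 ≤ C v))
    (hlow : ∀ κ : ZpExtension ℚ 2, κ.IsCyclotomic →
      2 ^ a ≤ Nat.card {z : W.selmerLayer κ j // 2 • z = 0})
    (hup : ∀ κ : ZpExtension ℚ 2, κ.IsCyclotomic →
      Nat.card {z : W.selmerLayer κ j' // 2 • z = 0} ≤ 2 ^ d)
    (harith : 2 ^ d * ∏ v ∈ S, (if ((2 : ℕ) : 𝓞 ℚ) ∈ v.asIdeal then 4 else C v) ^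
        (if ((2 : ℕ) : 𝓞 ℚ) ∈ v.asIdeal then 1
          else 2 ^ min j' (padicValNat 2 (Rat.HeightOneSpectrum.natGenerator v ^ 2 - 1) - 3)) <
      2 ^ (2 ^ j' - 2 ^ j + a))
    (hlan : AnalyticLambdaEq W 2 n) (hμan : AnalyticMuLE W 2 0) : MazurMainConjecture W 2 :=
  mazurMainConjecture_two_of_towerGap_of_layerSelmer W h17 h414 hper₀ hgo htors
    (towerGapAtTwo_of_layerSelmer_numeric W h33g hM hA hS34 hgo htors hjj' S hS C hC hlow hup harith)
    hrank hlan hμan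

end Curve

end Summit.BirchSwinnertonDyer.BirchSwinnertonDyer.Theorems.KatoHalfPinch

end
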